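import Mathlib.Analysis.InnerProductSpace.PiL2
import Mathlib.Analysis.SpecialFunctions.Pow.Real
import HarnessLib

/-!
# Gram form of a translation-invariant kernel (input of the Gram–Hadamard determinant bounds)

Topic `Literature/Analysis/InnerProduct`.  To bound the determinants `det G^{h,T}` of sliced
propagators by the Gram–Hadamard inequality one writes the single-scale propagator as an inner
product, `g^{(h)}(x - y) = ⟨A_x, B_y⟩` with `A_x(k) = e^{ikx} √f_h(k) / …`, `B_y(k) = e^{iky} √f_h(k) ⋯`
(Mastropietro 2008, §3.7 (3.50)–(3.52); Benfatto–Giuliani–Mastropietro 2006, (2.80): "a standard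
application of Gram–Hadamard inequality"), so that `‖A_x‖ ‖B_y‖` is controlled by the `L¹` norm of
the momentum-space cutoff.  On a finite set of momenta `K` (a finite torus) this is the following
elementary fact, for any kernel `g(x, y) = Σ_k χ_k(x) conj(χ_k(y)) ĝ(k)` with unimodular "plane
waves" `χ_k`:

* `gramLeft χ ĝ x`, `gramRight χ ĝ y` — the square-root split vectors in `ℓ²(K)`;
* `inner_gramLeft_gramRight` — `⟨A_x, B_y⟩ = Σ_k χ_k(x) conj(χ_k(y)) ĝ(k)`;
* `norm_gramLeft_sq`, `norm_gramRight_sq` — `‖A_x‖² = ‖B_y‖² = Σ_k |ĝ(k)|` (for `|χ_k(x)| = 1`).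

Everything is proved; no named fact. [folklore]

## Sources

V. Mastropietro, *Non-Perturbative Renormalization* (2008), §3.7, (3.50)–(3.52), PDF pp. 61–62 of
the held copy (`Mastropietro2008`); G. Benfatto, A. Giuliani, V. Mastropietro, Ann. Henri Poincaré 7
(2006), (2.80) (`BenfattoGiulianiMastropietro2006`).
-/

noncomputable section

open Finset
open scoped InnerProductSpace ComplexConjugate

namespace Literature.Analysis.InnerProduct

variable {K X : Type*} [Fintype K]

/-- The left Gram vector `A_x(k) = conj(χ_k(x)) √|ĝ(k)|` in `ℓ²(K)`. [folklore] -/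
def gramLeft (χ : K → X → ℂ) (ĝ : K → ℂ) (x : X) : EuclideanSpace ℂ K :=
  (WithLp.equiv 2 (K → ℂ)).symm fun k => conj (χ k x) * (Real.sqrt ‖ĝ k‖ : ℂ)

/-- The right Gram vector `B_y(k) = conj(χ_k(y)) ĝ(k)/√|ĝ(k)|` in `ℓ²(K)`. [folklore] -/
def gramRight (χ : K → X → ℂ) (ĝ : K → ℂ) (y : X) : EuclideanSpace ℂ K :=
  (WithLp.equiv 2 (K → ℂ)).symm fun k => conj (χ k y) * (ĝ k / (Real.sqrt ‖ĝ k‖ : ℂ))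

omit [Fintype K] in
/-- Components of the left Gram vector. [folklore] -/
@[simp] theorem gramLeft_apply (χ : K → X → ℂ) (ĝ : K → ℂ) (x : X) (k : K) :
    gramLeft χ ĝ x k = conj (χ k x) * (Real.sqrt ‖ĝ k‖ : ℂ) := rfl

omit [Fintype K] in
/-- Components of the right Gram vector. [folklore] -/
@[simp] theorem gramRight_apply (χ : K → X → ℂ) (ĝ : K → ℂ) (y : X) (k : K) :
    gramRight χ ĝ y k = conj (χ k y) * (ĝ k / (Real.sqrt ‖ĝ k‖ : ℂ)) := rfl

/-- `√|z| · (z/√|z|) = z` (with `0/0 = 0`). [folklore] -/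
theorem sqrt_mul_div_sqrt (z : ℂ) : (Real.sqrt ‖z‖ : ℂ) * (z / (Real.sqrt ‖z‖ : ℂ)) = z := by
  by_cases hz : z = 0
  · simp [hz]
  · have h : (Real.sqrt ‖z‖ : ℂ) ≠ 0 := by
      rw [Ne, Complex.ofReal_eq_zero, Real.sqrt_eq_zero (norm_nonneg z), norm_eq_zero]; exact hz
    rw [mul_div_cancel₀ _ h]

/-- **The kernel is in Gram form**: `⟨A_x, B_y⟩ = Σ_k χ_k(x) conj(χ_k(y)) ĝ(k)`. [folklore] -/
theorem inner_gramLeft_gramRight (χ : K → X → ℂ) (ĝ : K → ℂ) (x y : X) :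
    ⟪gramLeft χ ĝ x, gramRight χ ĝ y⟫_ℂ = ∑ k, χ k x * conj (χ k y) * ĝ k := by
  rw [PiLp.inner_apply]
  refine sum_congr rfl fun k _ => ?_
  rw [gramLeft_apply, gramRight_apply, RCLike.inner_apply', map_mul, Complex.conj_conj, Complex.conj_ofReal]
  calc χ k x * (Real.sqrt ‖ĝ k‖ : ℂ) * (conj (χ k y) * (ĝ k / (Real.sqrt ‖ĝ k‖ : ℂ)))
      = χ k x * conj (χ k y) * ((Real.sqrt ‖ĝ k‖ : ℂ) * (ĝ k / (Real.sqrt ‖ĝ k‖ : ℂ))) := by ring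
    _ = χ k x * conj (χ k y) * ĝ k := by rw [sqrt_mul_div_sqrt]

/-- `‖A_x‖² = Σ_k |ĝ(k)|` for unimodular `χ`. [folklore] -/
theorem norm_gramLeft_sq (χ : K → X → ℂ) (hχ : ∀ k x, ‖χ k x‖ = 1) (ĝ : K → ℂ) (x : X) :
    ‖gramLeft χ ĝ x‖ ^ 2 = ∑ k, ‖ĝ k‖ := by
  rw [EuclideanSpace.norm_sq_eq]
  refine sum_congr rfl fun k _ => ?_
  rw [gramLeft_apply, norm_mul, Complex.norm_conj, hχ, one_mul, Complex.norm_real, Real.norm_eq_abs,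
    abs_of_nonneg (Real.sqrt_nonneg _), Real.sq_sqrt (norm_nonneg _)]

/-- `‖B_y‖² = Σ_k |ĝ(k)|` for unimodular `χ`. [folklore] -/
theorem norm_gramRight_sq (χ : K → X → ℂ) (hχ : ∀ k x, ‖χ k x‖ = 1) (ĝ : K → ℂ) (y : X) :
    ‖gramRight χ ĝ y‖ ^ 2 = ∑ k, ‖ĝ k‖ := by
  rw [EuclideanSpace.norm_sq_eq]
  refine sum_congr rfl fun k _ => ?_
  rw [gramRight_apply, norm_mul, Complex.norm_conj, hχ, one_mul, norm_div, Complex.norm_real, Real.norm_eq_abs,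
    abs_of_nonneg (Real.sqrt_nonneg _)]
  by_cases h : ĝ k = 0
  · simp [h]
  · have hpos : 0 < ‖ĝ k‖ := norm_pos_iff.2 h
    rw [div_pow, Real.sq_sqrt hpos.le, pow_two, mul_div_assoc, div_self hpos.ne', mul_one]

/-- **Gram form with norms** (Mastropietro 2008, (3.50)–(3.52)): the kernel
`g(x,y) = Σ_k χ_k(x) conj(χ_k(y)) ĝ(k)` with `|χ_k| = 1` is `⟨A_x, B_y⟩` with
`‖A_x‖ = ‖B_y‖ = (Σ_k |ĝ(k)|)^{1/2}`; hence an `m × m` matrix of such kernel values has determinant at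
most `(Σ_k |ĝ(k)|)^m` by Gram–Hadamard. [cite: Mastropietro2008, §3.7 (3.50)-(3.52)] -/
theorem exists_gram_form (χ : K → X → ℂ) (hχ : ∀ k x, ‖χ k x‖ = 1) (ĝ : K → ℂ) :
    ∃ A B : X → EuclideanSpace ℂ K,
      (∀ x y, ⟪A x, B y⟫_ℂ = ∑ k, χ k x * conj (χ k y) * ĝ k) ∧
      (∀ x, ‖A x‖ = Real.sqrt (∑ k, ‖ĝ k‖)) ∧ ∀ y, ‖B y‖ = Real.sqrt (∑ k, ‖ĝ k‖) :=
  ⟨gramLeft χ ĝ, gramRight χ ĝ, inner_gramLeft_gramRight χ ĝ,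
    fun x => by rw [← norm_gramLeft_sq χ hχ ĝ x, Real.sqrt_sq (norm_nonneg _)],
    fun y => by rw [← norm_gramRight_sq χ hχ ĝ y, Real.sqrt_sq (norm_nonneg _)]⟩

end Literature.Analysis.InnerProduct
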